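import Summits.CriticalPhenomena.CardyFormulaZ2.Theses.CardyBoundaryCoulombGas
import Literature.Analysis.SpecialFunctions.SechCosineTransform
import Literature.NumberTheory.LFunctions.KadiriStechkinFarZeros
import Literature.NumberTheory.LFunctions.VinogradovKorobovCotBound

/-!
# Partial fractions of the Bethe scattering kernel (line `two-cluster-rate-is-stationary-gap`,
crux `StripClusterRates`)

The scattering kernel of the ground-state Bethe equations of the open staggered TL(1) chain at
`γ = π/3` is `G'(x) = d/dx arctan(tanh x/√3) = (√3/2)/(cosh 2x + 1/2) = sin θ/(cosh 2x - cos θ)`,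
`θ = 2π/3`. This file proves its Mittag-Leffler expansion into PAIRED Lorentzians
(registered helper `bu_kernel_partialFraction`, H-d1 of the kernel-positivity infrastructure):

  `G'(x) = Σ_{n ≥ 0} [a_n/(x² + a_n²) - b_n/(x² + b_n²)]`, `a_n = π/3 + πn`, `b_n = 2π/3 + πn`.

## Proof

* `bu_hasSum_inv_add_nat_sub_succ`: the telescoping sum `Σ_{n ≥ 0} [1/(z+n) - 1/(z+n+1)] = 1/z`
  on `ℂ ∖ ℤ` (summable by Mathlib's `EisensteinSeries.summable_linear_right_add_one_mul_linear_right`).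
* `bu_hasSum_inv_add_nat_add_inv_sub_succ`: adding it to the cotangent expansion
  `π cot(πz) - 1/z = Σ_{n ≥ 0} [1/(z-(n+1)) + 1/(z+(n+1))]` (Mathlib's `cot_series_rep'`, in the tree as
  `Literature.Analysis.SpecialFunctions.hasSum_cot_sub_inv`) gives the half-shifted form
  `π cot(πz) = Σ_{n ≥ 0} [1/(z+n) + 1/(z-(n+1))]`.
* Real parts at `z = 1/3 + (x/π) i`: `Re 1/(z+n) = π a_n/(x² + a_n²)`, `Re 1/(z-(n+1)) = -π b_n/(x² + b_n²)`
  and `Re cot(π/3 + xi) = (√3/2)/(cosh 2x + 1/2)` (`Re cot(a + bi) = sin a cos a/(sin² a + sinh² b)`,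
  the tree's `Literature.NumberTheory.LFunctions.FordCot.re_cot_ofReal_add_mul_I`, and
  `Re 1/(u + vi) = u/(u² + v²)`, `Literature.NumberTheory.LFunctions.KadiriStechkin.re_inv_eq`).

## References

* G. E. Andrews, R. Askey, R. Roy, *Special Functions* (1999), §1.2 (1.2.5) (partial fractions of `π cot πz`).
-/

noncomputable section

namespace Summit.CriticalPhenomena.CardyFormulaZ2.Cruxes.StripClusterRates.TwoClusterRateIsStationaryGap

open Filter Complex Real
open scoped Topology

/-- Telescoping on `ℂ ∖ ℤ`: `Σ_{n ≥ 0} [1/(z+n) - 1/(z+(n+1))] = 1/z` (absolutely convergent, the terms being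
`1/((z+n)(z+n+1))`). [folklore] -/
theorem bu_hasSum_inv_add_nat_sub_succ {z : ℂ} (hz : z ∈ Complex.integerComplement) :
    HasSum (fun n : ℕ => 1 / (z + n) - 1 / (z + (n + 1))) (1 / z) := by
  have hne : ∀ m : ℕ, z + m ≠ 0 := fun m => by
    exact_mod_cast Complex.integerComplement_add_ne_zero hz (m : ℤ)
  have hs : Summable fun n : ℕ => 1 / (z + n) - 1 / (z + (n + 1)) := by
    have h1 := (EisensteinSeries.summable_linear_right_add_one_mul_linear_right z 1 1).comp_injective
      (Nat.cast_injective (R := ℤ))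
    refine h1.congr fun n => ?_
    have ha : z + n ≠ 0 := hne n
    have hb : z + n + 1 ≠ 0 := by
      have := hne (n + 1)
      push_cast at this
      rwa [← add_assoc] at this
    simp only [Function.comp_apply, Int.cast_natCast, Int.cast_one, one_mul]
    rw [← add_assoc]
    field_simp
    ring
  rw [hs.hasSum_iff_tendsto_nat]
  have hsum : ∀ K : ℕ, ∑ n ∈ Finset.range K, (1 / (z + n) - 1 / (z + (n + 1))) = 1 / z - 1 / (z + K) := by
    intro K
    have h := Finset.sum_range_sub' (fun n : ℕ => 1 / (z + (n : ℂ))) K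
    simp only [Nat.cast_add, Nat.cast_one, Nat.cast_zero, add_zero] at h
    exact h
  rw [show (fun K : ℕ => ∑ n ∈ Finset.range K, (1 / (z + n) - 1 / (z + (n + 1)))) =
      fun K : ℕ => 1 / z - 1 / (z + K) from funext hsum]
  have h0 := EisensteinSeries.tendsto_zero_inv_linear z 1
  simp only [Int.cast_one, one_mul] at h0
  simpa using (tendsto_const_nhds (x := 1 / z)).sub h0

/-- **The cotangent expansion in half-shifted form**: for `z ∈ ℂ ∖ ℤ`,
`π cot(πz) = Σ_{n ≥ 0} [1/(z+n) + 1/(z-(n+1))]` (the pole at `-n` paired with the pole at `n+1`;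
absolutely convergent). [cite: AndrewsAskeyRoy1999, §1.2 (1.2.5)] -/
theorem bu_hasSum_inv_add_nat_add_inv_sub_succ {z : ℂ} (hz : z ∈ Complex.integerComplement) :
    HasSum (fun n : ℕ => 1 / (z + n) + 1 / (z - (n + 1))) (π * Complex.cot (π * z)) := by
  have h1 := Literature.Analysis.SpecialFunctions.hasSum_cot_sub_inv hz
  have h2 := bu_hasSum_inv_add_nat_sub_succ hz
  have h := h1.add h2
  rw [sub_add_cancel] at h
  refine h.congr_fun fun n => ?_
  ring

/-- `Re cot(π/3 + xi) = (√3/2)/(cosh 2x + 1/2)` (`= sin(2π/3)/(cosh 2x - cos(2π/3))`, the Bethe scattering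
kernel `G'`). [folklore] -/
theorem bu_re_cot_pi_div_three_add_mul_I (x : ℝ) :
    (Complex.cot (((π / 3 : ℝ) : ℂ) + x * I)).re = Real.sqrt 3 / 2 / (Real.cosh (2 * x) + 1 / 2) := by
  rw [Literature.NumberTheory.LFunctions.FordCot.re_cot_ofReal_add_mul_I, Real.sin_pi_div_three,
    Real.cos_pi_div_three, Real.cosh_two_mul, Real.cosh_sq]
  have h3 : Real.sqrt 3 ^ 2 = 3 := Real.sq_sqrt (by norm_num)
  have hd1 : (Real.sqrt 3 / 2) ^ 2 + Real.sinh x ^ 2 ≠ 0 := by positivity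
  have hd2 : Real.sinh x ^ 2 + 1 + Real.sinh x ^ 2 + 1 / 2 ≠ 0 := by positivity
  rw [div_eq_div_iff hd1 hd2, div_pow, h3]
  ring

/-- **H-d1 · partial-fraction (Mittag-Leffler) expansion of the Bethe scattering kernel**
`G'(x) = (√3/2)/(cosh 2x + 1/2) = sin(2π/3)/(cosh 2x − cos(2π/3))` into PAIRED Lorentzians:
`G'(x) = Σ_{n ≥ 0} [a_n/(x² + a_n²) - b_n/(x² + b_n²)]`, `a_n = π/3 + πn`, `b_n = 2π/3 + πn` (registered helper of
`stmt-CriticalPhenomena-13878`; the real part of the half-shifted cotangent expansion at `z = 1/3 + (x/π)i`).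
[cite: AndrewsAskeyRoy1999, §1.2 (1.2.5)] -/
theorem bu_kernel_partialFraction : ∀ x : ℝ, HasSum (fun n : ℕ ↦ (Real.pi / 3 + Real.pi * n) / (x ^ 2 + (Real.pi / 3 + Real.pi * n) ^ 2) - (2 * Real.pi / 3 + Real.pi * n) / (x ^ 2 + (2 * Real.pi / 3 + Real.pi * n) ^ 2)) (Real.sqrt 3 / 2 / (Real.cosh (2 * x) + 1 / 2)) := by
  intro x
  have hπ : Real.pi ≠ 0 := Real.pi_ne_zero
  have hπC : (π : ℂ) ≠ 0 := Complex.ofReal_ne_zero.mpr hπ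
  set z : ℂ := ((1 / 3 : ℝ) : ℂ) + ((x / π : ℝ) : ℂ) * I with hz
  have hzI : z ∈ Complex.integerComplement := by
    rw [Complex.mem_integerComplement_iff]
    rintro ⟨m, hm⟩
    have h := congrArg Complex.re hm
    simp [hz] at h
    have h3 : (3 * m : ℤ) = (1 : ℤ) := by
      have : (3 * m : ℝ) = 1 := by rw [h]; norm_num
      exact_mod_cast this
    omega
  have hC := Complex.hasSum_re (bu_hasSum_inv_add_nat_add_inv_sub_succ hzI)
  have hterm : ∀ n : ℕ, (1 / (z + n) + 1 / (z - (n + 1))).re =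
      π * ((π / 3 + π * n) / (x ^ 2 + (π / 3 + π * n) ^ 2) -
        (2 * π / 3 + π * n) / (x ^ 2 + (2 * π / 3 + π * n) ^ 2)) := by
    intro n
    have e1 : z + n = ((1 / 3 + n : ℝ) : ℂ) + ((x / π : ℝ) : ℂ) * I := by rw [hz]; push_cast; ring
    have e2 : z - (n + 1) = ((-(2 / 3 + n) : ℝ) : ℂ) + ((x / π : ℝ) : ℂ) * I := by rw [hz]; push_cast; ring
    rw [Complex.add_re, e1, e2, Literature.NumberTheory.LFunctions.KadiriStechkin.re_inv_eq,
      Literature.NumberTheory.LFunctions.KadiriStechkin.re_inv_eq, neg_sq]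
    have hA : (1 / 3 + n : ℝ) ^ 2 + (x / π) ^ 2 ≠ 0 := by positivity
    have hB : (2 / 3 + n : ℝ) ^ 2 + (x / π) ^ 2 ≠ 0 := by positivity
    have hA' : x ^ 2 + (π / 3 + π * n) ^ 2 ≠ 0 := by positivity
    have hB' : x ^ 2 + (2 * π / 3 + π * n) ^ 2 ≠ 0 := by positivity
    field_simp
    ring
  have hval : ((π : ℂ) * Complex.cot (π * z)).re = π * (Real.sqrt 3 / 2 / (Real.cosh (2 * x) + 1 / 2)) := by
    have e3 : (π : ℂ) * z = ((π / 3 : ℝ) : ℂ) + x * I := by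
      rw [hz]; push_cast; field_simp
    rw [Complex.re_ofReal_mul, e3, bu_re_cot_pi_div_three_add_mul_I]
  rw [hval] at hC
  have hC' := hC.congr_fun (g := fun n : ℕ => π * ((π / 3 + π * n) / (x ^ 2 + (π / 3 + π * n) ^ 2) -
      (2 * π / 3 + π * n) / (x ^ 2 + (2 * π / 3 + π * n) ^ 2))) fun n => (hterm n).symm
  exact (hasSum_mul_left_iff hπ).1 hC'

end Summit.CriticalPhenomena.CardyFormulaZ2.Cruxes.StripClusterRates.TwoClusterRateIsStationaryGap

end
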